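import Mathlib
import Summits.MatrixMultiplication.MatrixMultiplication.Theses.HiddenToeplitzCorners

/-!
# Law of ends — the NEGATION door of crux `HiddenCorners` (stmt-MatrixMultiplication-7492), typed and bridged

Crux-strategist wall-breaker pass (planner-cstrat-stmt-MatrixMultiplication-7492-p1-0, 2026-08-17), companion of
`STRATEGY-CENSUS.md` §7.  Disproof-side material (no `HiddenCorners_of` here: the census records why no constructive
line is registered).

* `SplitSP r N d T` — the body of the crux at one `(r, N, d, T)`: split Stein generators of width `d`, generically
  nonsingular, singular on every singular `X` (the size and sparsity clauses are deliberately DROPPED — no no-go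
  theorem on record uses them, and dropping them only strengthens the refutation bridge).
* `SplitNeutralLaw c k` — the ω-neutral law in the crux's own currency (split width `d`), in POLYNOMIAL form:
  every split-SP pencil has `r ≤ c · (d + 1) ^ k`.  `k = 1` is the conjectured law of ends (`r ≤ 2δ ≤ 4d`, HCL-R form);
  any fixed `k` suffices to kill the crux.
* `splitNeutralLaw_refutes` — PROVED: `1 ≤ k → SplitNeutralLaw c k → ¬ HiddenCorners`.  So the moment ANY polynomial
  neutral law lands (from the HCL-R programme, stmt-10752, extended to frame-free certificates), the crux closes
  `refuted` mechanically through this lemma.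
-/

set_option linter.dupNamespace false

namespace Summit.MatrixMultiplication.MatrixMultiplication.Cruxes.HiddenCorners.LawOfEnds

open Summit.MatrixMultiplication.MatrixMultiplication.Theses.HiddenToeplitzCorners
open scoped BigOperators Matrix
open Filter

/-- The lower shift `Z` on `ℂ^N` (route convention, inlined exactly as in the crux). -/
noncomputable def shiftZ (N : ℕ) : Matrix (Fin N) (Fin N) ℂ :=
  Matrix.of fun i j : Fin N => if (i : ℕ) = (j : ℕ) + 1 then (1 : ℂ) else 0

/-- The crux's body at one `(r, N, d, T)` WITHOUT the size and sparsity clauses: split Stein generators of width `d`,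
one nonsingular value, singular on every singular `X`. -/
def SplitSP (r N d : ℕ) (T : Fin r → Fin r → Matrix (Fin N) (Fin N) ℂ) : Prop :=
  (∃ (G₀ H₀ : Matrix (Fin N) (Fin d) ℂ) (G₁ H₁ : Fin r → Fin r → Matrix (Fin N) (Fin d) ℂ),
      ∀ a b, T a b - shiftZ N * T a b * (shiftZ N)ᵀ = G₀ * (H₁ a b)ᵀ + G₁ a b * H₀ᵀ) ∧
    (∃ X₀ : Matrix (Fin r) (Fin r) ℂ, (∑ a : Fin r, ∑ b : Fin r, X₀ a b • T a b).det ≠ 0) ∧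
    ∀ X : Matrix (Fin r) (Fin r) ℂ, X.det = 0 → (∑ a : Fin r, ∑ b : Fin r, X a b • T a b).det = 0

/-- The ω-NEUTRAL LAW in split-width currency, polynomial form: every split-SP pencil has `r ≤ c · (d + 1) ^ k`.
Conjectured with `k = 1` (law of ends: `r ≤ 2·δ ≤ 4d`; HCL-R is its frame case; tight up to one by the W-chain family). -/
def SplitNeutralLaw (c k : ℕ) : Prop :=
  ∀ (r N d : ℕ) (T : Fin r → Fin r → Matrix (Fin N) (Fin N) ℂ), SplitSP r N d T → r ≤ c * (d + 1) ^ k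

/-- Real-analysis core: with `ε = 1/(2k)`, eventually `c · (r^ε + 1)^k < r`. -/
lemma eventually_law_lt (c k : ℕ) (hk : 1 ≤ k) :
    ∀ᶠ r : ℕ in atTop, (c : ℝ) * ((r : ℝ) ^ (1 / (2 * (k : ℝ))) + 1) ^ k < (r : ℝ) := by
  have hkpos : (0 : ℝ) < k := by exact_mod_cast hk
  set ε : ℝ := 1 / (2 * (k : ℝ)) with hε
  have hεpos : 0 < ε := by rw [hε]; positivity
  have hεk : ε * k = 1 / 2 := by rw [hε]; field_simp
  -- for r ≥ 1: (r^ε + 1)^k ≤ (2 r^ε)^k = 2^k * r^(1/2)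
  have key : ∀ r : ℕ, 1 ≤ r → (c : ℝ) * ((r : ℝ) ^ ε + 1) ^ k ≤ (c : ℝ) * 2 ^ k * Real.sqrt r := by
    intro r hr
    have hr' : (1 : ℝ) ≤ r := by exact_mod_cast hr
    have hrpos : (0 : ℝ) ≤ r := by linarith
    have h1 : (1 : ℝ) ≤ (r : ℝ) ^ ε := Real.one_le_rpow hr' hεpos.le
    have h2 : (r : ℝ) ^ ε + 1 ≤ 2 * (r : ℝ) ^ ε := by linarith
    have h3 : ((r : ℝ) ^ ε + 1) ^ k ≤ (2 * (r : ℝ) ^ ε) ^ k := by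
      apply pow_le_pow_left₀ (by positivity) h2
    have h4 : (2 * (r : ℝ) ^ ε) ^ k = 2 ^ k * Real.sqrt r := by
      rw [mul_pow, ← Real.rpow_natCast ((r : ℝ) ^ ε) k, ← Real.rpow_mul hrpos, hεk, Real.sqrt_eq_rpow]
    calc (c : ℝ) * ((r : ℝ) ^ ε + 1) ^ k ≤ (c : ℝ) * (2 * (r : ℝ) ^ ε) ^ k := by
          apply mul_le_mul_of_nonneg_left h3 (by positivity)
      _ = (c : ℝ) * 2 ^ k * Real.sqrt r := by rw [h4]; ring
  -- eventually c 2^k sqrt r < r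
  set M : ℝ := (c : ℝ) * 2 ^ k with hM
  have hMnn : 0 ≤ M := by rw [hM]; positivity
  have hev : ∀ᶠ r : ℕ in atTop, M * Real.sqrt r < (r : ℝ) ∧ 1 ≤ r := by
    have hA : ∀ᶠ r : ℕ in atTop, (M + 1) ^ 2 ≤ (r : ℝ) := by
      obtain ⟨n, hn⟩ := exists_nat_ge ((M + 1) ^ 2)
      filter_upwards [eventually_ge_atTop n] with r hr
      calc (M + 1) ^ 2 ≤ (n : ℝ) := hn
        _ ≤ (r : ℝ) := by exact_mod_cast hr
    have hB : ∀ᶠ r : ℕ in atTop, 1 ≤ r := eventually_ge_atTop 1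
    filter_upwards [hA, hB] with r hA hB
    refine ⟨?_, hB⟩
    have hrpos : (0 : ℝ) < r := by exact_mod_cast hB
    have hs : M + 1 ≤ Real.sqrt r := by
      rw [show M + 1 = Real.sqrt ((M + 1) ^ 2) from (Real.sqrt_sq (by linarith)).symm]
      exact Real.sqrt_le_sqrt hA
    have hspos : 0 < Real.sqrt r := Real.sqrt_pos.mpr hrpos
    calc M * Real.sqrt r < (M + 1) * Real.sqrt r := by nlinarith
      _ ≤ Real.sqrt r * Real.sqrt r := by apply mul_le_mul_of_nonneg_right hs hspos.le
      _ = (r : ℝ) := Real.mul_self_sqrt hrpos.le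
  filter_upwards [hev] with r ⟨hr, hr1⟩
  calc (c : ℝ) * ((r : ℝ) ^ (1 / (2 * (k : ℝ))) + 1) ^ k = (c : ℝ) * ((r : ℝ) ^ ε + 1) ^ k := by rw [hε]
    _ ≤ M * Real.sqrt r := by rw [hM]; exact key r hr1
    _ < r := hr

/-- **The bridge, proved.** Any polynomial ω-neutral law (any `c`, any `k ≥ 1`) refutes the crux `HiddenCorners`. -/
theorem splitNeutralLaw_refutes (c k : ℕ) (hk : 1 ≤ k) (hlaw : SplitNeutralLaw c k) : ¬ HiddenCorners := by
  intro hH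
  have hkpos : (0 : ℝ) < k := by exact_mod_cast hk
  set ε : ℝ := 1 / (2 * (k : ℝ)) with hε
  have hεpos : 0 < ε := by rw [hε]; positivity
  have hfreq := hH ε hεpos
  -- every witness at r obeys the law: r ≤ c (d+1)^k with d ≤ r^ε
  have hle : ∃ᶠ r : ℕ in atTop, (r : ℝ) ≤ (c : ℝ) * ((r : ℝ) ^ ε + 1) ^ k := by
    refine hfreq.mono ?_
    rintro r ⟨N, d, -, hd, T, G₀, H₀, G₁, H₁, hdisp, -, hX₀, hsing⟩
    have hsp : SplitSP r N d T := ⟨⟨G₀, H₀, G₁, H₁, hdisp⟩, hX₀, hsing⟩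
    have hr : r ≤ c * (d + 1) ^ k := hlaw r N d T hsp
    have hr' : (r : ℝ) ≤ (c : ℝ) * ((d : ℝ) + 1) ^ k := by exact_mod_cast hr
    have hd1 : (d : ℝ) + 1 ≤ (r : ℝ) ^ ε + 1 := by linarith
    have hdnn : (0 : ℝ) ≤ (d : ℝ) + 1 := by positivity
    calc (r : ℝ) ≤ (c : ℝ) * ((d : ℝ) + 1) ^ k := hr'
      _ ≤ (c : ℝ) * ((r : ℝ) ^ ε + 1) ^ k := by
          apply mul_le_mul_of_nonneg_left (pow_le_pow_left₀ hdnn hd1 k) (by positivity)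
  have hev := eventually_law_lt c k hk
  obtain ⟨r, h1, h2⟩ := (hle.and_eventually hev).exists
  rw [hε] at h1
  linarith

/-- The conjectured law of ends in the form the HCL-R programme is proving (`r ≤ 2·δ`, `δ ≤ 2d`): `k = 1`, `c = 4`.
Recorded as the concrete target; it refutes the crux through `splitNeutralLaw_refutes 4 1`. -/
def LawOfEnds : Prop := SplitNeutralLaw 4 1

theorem lawOfEnds_refutes (h : LawOfEnds) : ¬ HiddenCorners :=
  splitNeutralLaw_refutes 4 1 le_rfl h

end Summit.MatrixMultiplication.MatrixMultiplication.Cruxes.HiddenCorners.LawOfEnds
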